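import Summits.AtomisticToContinuum.HydrodynamicLimit.Theorems.CollisionIsometryCLTCollisionalTransferLocalityStressLawFixedAOfEvenStress
import Summits.AtomisticToContinuum.HydrodynamicLimit.Theorems.CollisionIsometryCLTCollisionalTransferLocalityStressLawSupOfFixedA
import Summits.AtomisticToContinuum.HydrodynamicLimit.Theorems.CollisionIsometryCLTCollisionalTransferLocalityEnvelopeA
import Summits.AtomisticToContinuum.HydrodynamicLimit.Theorems.CollisionIsometryCLTCollisionalTransferLocalityMarkDominationA
import HarnessLib

/-!
# The momentum engine of the crux `CollisionalTransferLocality` from the sibling crux `EvenStressEnskog`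
(line `hemisphere-affine-slaving`, stmt-AtomisticToContinuum-9518; registered helper `collisionalStressLaw_of_evenStress_of_twoScale`)

ASSEMBLY CERTIFICATE (seat c10, skeleton v19). The momentum-channel engine statement of the crux — `CollisionalStressLaw`
(…DefsD; registered as [Kσ] `stub_collisionalStressLaw`: uniformly in `τ ≤ t`, w.h.p., the flux-form sum of the gradient marks
`‖Δv‖ ω⊗ω:∇ψ` equals `∫₀^τ∫ [div ψ · p_c(ρ̄, θ̄) + (2/5)(Z − 1) D̄:∇ψ]` on mesoscale block fields) — FOLLOWS from
* the sibling crux `JParityClosure.EvenStressEnskog` (stmt-13079, hypothesis, BY NAME): the `J`-even collisional momentum-transfer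
  marks take Enskog's value on `r`-mollified fields, `N → ∞` before `r → 0`;
* the ONE-BODY two-scale statement [TS] (registered research stub `stub_twoScaleValueA`, hypothesis, verbatim): the value functional
  `RhsA + KfunA` on cone-kernel (`b_r`) block fields equals the same functional on mesoscale (`φ_N`) block fields, w.h.p., `N → ∞` before `r → 0`;
through the LANDED glue of the line: [DockA] `stub_stressLawFixedA_of_evenStressEnskog` (p145343: 13079 ∧ [TS] ⇒ the fixed-time law [KσA] for every
smooth matrix weight — inert cutoff by `stub_mollDensity_le_of_blockCeiling`, mark-sum identity `stub_markSumA_eq_evenCollisionSums_of_inert`,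
macroscale value identity `ParityBandClosurePressureValue.sum_enskog_integral_eq` + `stub_coneValue_eq`), [SupA]
`stub_collisionalStressLaw_of_fixedA` (p142817: fixed-time laws at `A = ∇ψ` and `A = 𝟙` ⇒ the sup-τ law on a grid), [EnvA] `stub_envelopeA`
(p142275), [DomA] `stub_markDominationA` (p142443). Hence the crux's momentum research content is {13079, [TS]}.
References: Chapman–Cowling (1970) §16.4; van Beijeren–Ernst, Physica 68 (1973) 437.
-/

namespace Summit.AtomisticToContinuum.HydrodynamicLimit.Theorems.HemisphereAffineSlaving

open scoped BigOperators Topology Classical ENNReal InnerProductSpace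
open Filter Set Function MeasureTheory

noncomputable section

open Literature.MathematicalPhysics.KineticTheory (T3 V3)

/-- **Registered helper `collisionalStressLaw_of_evenStress_of_twoScale`.** `EvenStressEnskog` (13079) and the two-scale value statement [TS]
imply the momentum engine `CollisionalStressLaw` of the crux `CollisionalTransferLocality` ([DockA] then [SupA] with [EnvA], [DomA]). -/
theorem collisionalStressLaw_of_evenStress_of_twoScale : Summit.AtomisticToContinuum.HydrodynamicLimit.Theses.JParityClosure.EvenStressEnskog → (∀ (a₀ θ₀ : T3 → ℝ) (u₀ : T3 → V3), NiceProfiles a₀ θ₀ u₀ → ∃ σ₀ : ℝ, 0 < σ₀ ∧ ∃ η₁ : ℝ, 0 < η₁ ∧ ∀ σ : ℝ, 0 < σ → σ < σ₀ → ∀ (Φ : Flows σ) (t : ℝ), 0 < t → ∀ (γ C : ℝ) (φ : ℕ → T3 → ℝ), 0 < γ → γ ≤ 1 / 15 → AdmissibleKernel γ C φ → DiluteAt σ a₀ θ₀ u₀ Φ t φ η₁ → ∀ (A : ℝ → T3 → Fin 3 → Fin 3 → ℝ), SmoothMatrixOn (Icc 0 t) A → ∀ τ ∈ Icc 0 t,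 ∀ η δ : ℝ, 0 < η → 0 < δ → ∃ r₀ : ℝ, 0 < r₀ ∧ ∀ r : ℝ, 0 < r → r < r₀ → ∃ N₀ : ℕ, ∀ N : ℕ, N₀ ≤ N → Literature.MathematicalPhysics.KineticTheory.localGibbsLaw σ a₀ u₀ θ₀ N (Φ N) {z | η < |(RhsA σ Φ (fun (_ : ℕ) (y : T3) => Literature.MathematicalPhysics.KineticTheory.coneKernel r y 0) A N z τ + KfunA σ Φ (fun (_ : ℕ) (y : T3) => Literature.MathematicalPhysics.KineticTheory.coneKernel r y 0) A N z τ) - (RhsA σ Φ φ A N z τ + KfunA σ Φ φ A N z τ)|} ≤ ENNReal.ofReal δ) → CollisionalStressLaw :=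
  fun h79 hTS => stub_collisionalStressLaw_of_fixedA (stub_stressLawFixedA_of_evenStressEnskog h79 hTS)
    stub_envelopeA stub_markDominationA

end

end Summit.AtomisticToContinuum.HydrodynamicLimit.Theorems.HemisphereAffineSlaving
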